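import Literature.Analysis.FluidPDE.JiaSverak2013AprioriEstimateProofs
import HarnessLib

/-!
# Jia–Šverák 2013, Corollary 1 (local energy bounds for `L³` data), proved

Analysis/FluidPDE glue file (theorems only) **discharging the named fact
`Literature.Analysis.FluidPDE.jia_sverak_2013_corollary_1`** (`JiaSverak2013Compactness.lean`;
Jia–Šverák, SIAM J. Math. Anal. 45 (2013) = arXiv:1201.1592, Cor. 1 p. 4: for a Leray solution
with datum `u₀ ∈ L³`, `∫₀^{r²}∫_{B_r(x₀)} |∇u|² + esssup_{t ≤ r²} ∫_{B_r(x₀)} |u|²/2 ≲ ‖u₀‖₃² r`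
and `∫₀^{r²}∫_{B_r(x₀)} |p - p(t)|^{3/2} ≲ ‖u₀‖₃³ r²`, with the printed dependence on
`ε₀ min{‖u₀‖₃⁻⁴, 1}`). The printed proof "For each `r > 0`, let `R = r/√(ε₀ min{‖u₀‖₃⁻⁴,1})` …
We shall apply Lemma 2 with this `R`" is the accepted reduction
`jia_sverak_2013_corollary_1_of_lemma_2` (`JiaSverak2013AprioriEstimate.lean`), and Lemma 2 is
now the theorem `jia_sverak_2013_lemma_2_holds` (`JiaSverak2013AprioriEstimateProofs.lean`).

## References

* H. Jia, V. Šverák, SIAM J. Math. Anal. 45 (2013) 1448–1459 = arXiv:1201.1592: Cor. 1 and its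
  proof (p. 4), Lemma 2 (pp. 3–4). Bib key `JiaSverak2013`.
-/

noncomputable section

namespace Literature.Analysis.FluidPDE

/-- **Jia–Šverák 2013, Corollary 1, proved** (the named fact `jia_sverak_2013_corollary_1`):
Cor. 1 follows from Lemma 2 by the printed choice of `R` and `λ`
(`jia_sverak_2013_corollary_1_of_lemma_2`), and Lemma 2 is `jia_sverak_2013_lemma_2_holds`.
[cite: JiaSverak2013, Cor. 1 and its proof from Lemma 2 (arXiv:1201.1592 p. 4)] -/
theorem jia_sverak_2013_corollary_1_holds : jia_sverak_2013_corollary_1 :=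
  jia_sverak_2013_corollary_1_of_lemma_2 jia_sverak_2013_lemma_2_holds

end Literature.Analysis.FluidPDE

end
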